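import Literature.Analysis.FluidPDE.TaoY6Tonelli
import Literature.Analysis.FluidPDE.EnergyToolkit
import Mathlib.Topology.MetricSpace.Thickening
import HarnessLib

/-!
# The two Cauchy–Schwarz/Tonelli bounds of the `Y₆` estimate on a Whitney piece

Analysis/FluidPDE support file for the discharge of the named fact
`Literature.Analysis.FluidPDE.tao2011_nonlinearEstimate` (Tao 2011, §10, proof of Thm. 10.1,
estimate of `Y₆`, arXiv:1108.1165 pp. 32–33). After the integration by parts of
`FluidPDE/TaoY6PieceIBP`, the contribution of the near field `H` on a piece `χ` at scale `r` is
bounded by the two quantities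

  `I = ∫ ‖Dω‖ ‖ω‖ ‖H‖ η χ`   and   `II = ∫_{supp χ} ‖ω‖² ‖H‖`,

with `‖H(y)‖² ≤ C_H ∫_{B̄(y,2r)} |Dω|²` (`FluidPDE/TaoY6LocalBiotSavart`). This file proves the two
abstract bounds (Tao's Hölder step "`Y₆,₁ ≲ … Σᵢ rᵢ^{3/2}‖ω‖²_{L⁶(Bᵢ)}‖ω‖_{L²(2Bᵢ)}`" and the bound
(10.23) for the local masses, here in `L²` form):

* `sq_integral_mul_norm_mul_le` (for `I`): if `‖H(y)‖² ≤ C_H ∫_{B̄(y,R)} Φ` then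
  `(∫ A ‖ω‖ ‖H‖ w)² ≤ (∫ A² w) · C_H (∫ ‖ω‖² η) ∫_{N} Φ`, `N` the closed `R`-neighbourhood of
  `supp w`, for weights `0 ≤ w ≤ η` — the local weighted masses `∫_{B̄(x,R)} ‖ω‖² w` are trivially
  `≤ ∫ ‖ω‖²η` (Tonelli, `FluidPDE/TaoY6Tonelli`);
* `sq_setIntegral_sq_norm_mul_norm_le` (for `II`): if the *unweighted* local masses near a compact
  `S` are bounded, `∫_{B̄(x,R) ∩ S} ‖ω‖² ≤ m`, then
  `(∫_S ‖ω‖²‖H‖)² ≤ C_H m (∫_N Φ) ∫_S ‖ω‖²` — this is where the Whitney-scale mass bound enters.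

## References

* T. Tao, arXiv:1108.1165 (`Tao2011`), §10, proof of Thm. 10.1, pp. 32–33.
-/

noncomputable section

open MeasureTheory Set Filter Metric Function
open scoped ENNReal NNReal

namespace Literature.Analysis.FluidPDE.TaoY6

variable {E : Type*} [MeasurableSpace E] [MetricSpace E] [BorelSpace E]
  [SecondCountableTopology E] [ProperSpace E] {μ : Measure E} [SFinite μ] [IsLocallyFiniteMeasure μ]

/-- **Overlap bound at a fixed scale**, variant of
`integral_le_of_le_mul_setIntegral_closedBall` for a measurable, locally integrable weight `a`
(e.g. a continuous function cut off to a closed set). [folklore] -/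
theorem integral_le_of_le_mul_setIntegral_closedBall' {f a φ : E → ℝ} (hf0 : ∀ y, 0 ≤ f y)
    (hfm : AEStronglyMeasurable f μ) (ha0 : ∀ y, 0 ≤ a y) (ham : Measurable a)
    {R : ℝ} (haint : ∀ x, IntegrableOn a (closedBall x R) μ)
    (hφ0 : ∀ x, 0 ≤ φ x) (hφc : Continuous φ) {M : ℝ} (hM0 : 0 ≤ M)
    (hpt : ∀ y, f y ≤ a y * ∫ x in closedBall y R, φ x ∂μ)
    (hM : ∀ x, ∫ y in closedBall x R, a y ∂μ ≤ M) {N : Set E} (hN : MeasurableSet N)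
    (hNa : ∀ x ∉ N, ∀ y ∈ tsupport a, R < dist y x) (hφN : IntegrableOn φ N μ) :
    ∫ y, f y ∂μ ≤ M * ∫ x in N, φ x ∂μ := by
  have ham' : Measurable fun y => ENNReal.ofReal (a y) := ENNReal.measurable_ofReal.comp ham
  have hφm : Measurable fun x => ENNReal.ofReal (φ x) := ENNReal.measurable_ofReal.comp hφc.measurable
  have hballφ : ∀ y, ENNReal.ofReal (∫ x in closedBall y R, φ x ∂μ) =
      ∫⁻ x in closedBall y R, ENNReal.ofReal (φ x) ∂μ := fun y =>
    ofReal_integral_eq_lintegral_ofReal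
      (hφc.continuousOn.integrableOn_compact (isCompact_closedBall y R))
      (Eventually.of_forall fun x => hφ0 x)
  have hballa : ∀ x, ENNReal.ofReal (∫ y in closedBall x R, a y ∂μ) =
      ∫⁻ y in closedBall x R, ENNReal.ofReal (a y) ∂μ := fun x =>
    ofReal_integral_eq_lintegral_ofReal (haint x) (Eventually.of_forall fun y => ha0 y)
  have hIN : 0 ≤ ∫ x in N, φ x ∂μ := integral_nonneg fun x => hφ0 x
  have hchain : ∫⁻ y, ENNReal.ofReal (f y) ∂μ ≤ ENNReal.ofReal (M * ∫ x in N, φ x ∂μ) := by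
    calc ∫⁻ y, ENNReal.ofReal (f y) ∂μ
        ≤ ∫⁻ y, ENNReal.ofReal (a y) * ∫⁻ x in closedBall y R, ENNReal.ofReal (φ x) ∂μ ∂μ := by
          refine lintegral_mono fun y => ?_
          rw [← hballφ, ← ENNReal.ofReal_mul (ha0 y)]
          exact ENNReal.ofReal_le_ofReal (hpt y)
      _ = ∫⁻ x, ENNReal.ofReal (φ x) * ∫⁻ y in closedBall x R, ENNReal.ofReal (a y) ∂μ ∂μ :=
          lintegral_mul_setLIntegral_closedBall_comm ham' hφm R
      _ ≤ ∫⁻ x, ENNReal.ofReal (φ x) * N.indicator (fun _ => ENNReal.ofReal M) x ∂μ := by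
          refine lintegral_mono fun x => mul_le_mul' le_rfl ?_
          by_cases hxN : x ∈ N
          · rw [indicator_of_mem hxN, ← hballa]
            exact ENNReal.ofReal_le_ofReal (hM x)
          · rw [indicator_of_notMem hxN]
            have h0 : ∫⁻ y in closedBall x R, ENNReal.ofReal (a y) ∂μ = 0 := by
              refine setLIntegral_closedBall_eq_zero_of_dist fun y hy => hNa x hxN y ?_
              exact (tsupport_comp_subset ENNReal.ofReal_zero a) hy
            rw [h0]
      _ = ENNReal.ofReal M * ∫⁻ x in N, ENNReal.ofReal (φ x) ∂μ := by
          rw [← lintegral_indicator hN, ← lintegral_const_mul _ (hφm.indicator hN)]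
          refine lintegral_congr fun x => ?_
          by_cases hxN : x ∈ N
          · rw [indicator_of_mem hxN, indicator_of_mem hxN, mul_comm]
          · rw [indicator_of_notMem hxN, indicator_of_notMem hxN, mul_zero, mul_zero]
      _ = ENNReal.ofReal (M * ∫ x in N, φ x ∂μ) := by
          rw [ENNReal.ofReal_mul hM0, ofReal_integral_eq_lintegral_ofReal hφN
            (Eventually.of_forall fun x => hφ0 x)]
  rw [integral_eq_lintegral_of_nonneg_ae (Eventually.of_forall hf0) hfm]
  have := ENNReal.toReal_mono ENNReal.ofReal_ne_top hchain
  rwa [ENNReal.toReal_ofReal (mul_nonneg hM0 hIN)] at this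

omit [MeasurableSpace E] [BorelSpace E] [SecondCountableTopology E] [ProperSpace E] in
/-- Points outside the closed `R`-neighbourhood of a compact set are at distance `> R` from it.
[folklore] -/
theorem lt_dist_of_notMem_cthickening {S : Set E} (hS : IsCompact S) {R : ℝ} (hR : 0 ≤ R) {x : E}
    (hx : x ∉ cthickening R S) {y : E} (hy : y ∈ S) : R < dist y x := by
  by_contra h
  rw [not_lt] at h
  apply hx
  rw [hS.cthickening_eq_biUnion_closedBall hR]
  exact mem_biUnion hy (by rw [mem_closedBall, dist_comm]; exact h)

variable {F G : Type*} [NormedAddCommGroup F] [NormedAddCommGroup G]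

/-- **The bound for `I`.** Let `A, Φ ≥ 0` be continuous, `ω`, `H` continuous, `0 ≤ w ≤ η`
continuous with `w` compactly supported and `‖ω‖²η ∈ L¹`, and suppose
`‖H(y)‖² ≤ C_H ∫_{B̄(y,R)} Φ` for all `y`. Then, with `N` the closed `R`-neighbourhood of the
support of `w`, `(∫ A ‖ω‖ ‖H‖ w)² ≤ (∫ A² w) · (C_H (∫ ‖ω‖²η) ∫_N Φ)`. [folklore] -/
theorem sq_integral_mul_norm_mul_le {ω : E → F} {H : E → G} {A Φ w η : E → ℝ}
    (hωc : Continuous ω) (hHc : Continuous H) (hAc : Continuous A) (hA0 : ∀ y, 0 ≤ A y)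
    (hΦc : Continuous Φ) (hΦ0 : ∀ x, 0 ≤ Φ x) (hwc : Continuous w) (hws : HasCompactSupport w)
    (hw0 : ∀ y, 0 ≤ w y) (hwη : ∀ y, w y ≤ η y) (hηint : Integrable (fun y => ‖ω y‖ ^ 2 * η y) μ)
    {CH R : ℝ} (hCH : 0 ≤ CH) (hR : 0 ≤ R)
    (hH : ∀ y, ‖H y‖ ^ 2 ≤ CH * ∫ x in closedBall y R, Φ x ∂μ) :
    (∫ y, A y * ‖ω y‖ * ‖H y‖ * w y ∂μ) ^ 2 ≤
      (∫ y, A y ^ 2 * w y ∂μ) * (CH * (∫ y, ‖ω y‖ ^ 2 * η y ∂μ) *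
        ∫ x in cthickening R (tsupport w), Φ x ∂μ) := by
  have hK : IsCompact (tsupport w) := hws
  -- Cauchy–Schwarz with `f = A √w`, `g = ‖ω‖ ‖H‖ √w`
  set f : E → ℝ := fun y => A y * Real.sqrt (w y) with hf
  set g : E → ℝ := fun y => ‖ω y‖ * ‖H y‖ * Real.sqrt (w y) with hg
  have hsw : Continuous fun y => Real.sqrt (w y) := Real.continuous_sqrt.comp hwc
  have hsws : HasCompactSupport fun y => Real.sqrt (w y) :=
    hws.comp_left Real.sqrt_zero
  have hfc2 : Continuous f := hAc.mul hsw
  have hgc2 : Continuous g := (hωc.norm.mul hHc.norm).mul hsw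
  have hfs : HasCompactSupport f := hsws.mul_left
  have hgs : HasCompactSupport g := hsws.mul_left
  have hfm : MemLp f 2 μ := hfc2.memLp_of_hasCompactSupport hfs
  have hgm : MemLp g 2 μ := hgc2.memLp_of_hasCompactSupport hgs
  have hCS := integral_norm_mul_norm_le_sqrt_mul_sqrt hfm hgm
  have hfg : ∀ y, ‖f y‖ * ‖g y‖ = A y * ‖ω y‖ * ‖H y‖ * w y := fun y => by
    rw [Real.norm_eq_abs, Real.norm_eq_abs, hf, hg, abs_of_nonneg (mul_nonneg (hA0 y)
      (Real.sqrt_nonneg _)), abs_of_nonneg (by positivity)]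
    have := Real.mul_self_sqrt (hw0 y)
    calc A y * Real.sqrt (w y) * (‖ω y‖ * ‖H y‖ * Real.sqrt (w y))
        = A y * ‖ω y‖ * ‖H y‖ * (Real.sqrt (w y) * Real.sqrt (w y)) := by ring
      _ = A y * ‖ω y‖ * ‖H y‖ * w y := by rw [this]
  have hf2 : ∀ y, ‖f y‖ ^ 2 = A y ^ 2 * w y := fun y => by
    rw [Real.norm_eq_abs, sq_abs, hf, mul_pow, Real.sq_sqrt (hw0 y)]
  have hg2 : ∀ y, ‖g y‖ ^ 2 = ‖ω y‖ ^ 2 * ‖H y‖ ^ 2 * w y := fun y => by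
    rw [Real.norm_eq_abs, sq_abs, hg, mul_pow, mul_pow, Real.sq_sqrt (hw0 y)]
  simp_rw [hfg, hf2, hg2] at hCS
  -- the second factor: pointwise `‖ω‖²‖H‖²w ≤ (CH ‖ω‖² w) ∫_{B̄} Φ`, then Tonelli
  have hX : ∫ y, ‖ω y‖ ^ 2 * ‖H y‖ ^ 2 * w y ∂μ ≤
      (∫ y, ‖ω y‖ ^ 2 * η y ∂μ) * (CH * ∫ x in cthickening R (tsupport w), Φ x ∂μ) := by
    have hNa : ∀ x ∉ cthickening R (tsupport w), ∀ y ∈ tsupport (fun y => CH * (‖ω y‖ ^ 2 * w y)),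
        R < dist y x := by
      intro x hx y hy
      refine lt_dist_of_notMem_cthickening hK hR hx ?_
      exact (tsupport_mul_subset_right.trans (tsupport_mul_subset_right)) hy
    have h := integral_le_of_le_mul_setIntegral_closedBall (μ := μ)
      (f := fun y => ‖ω y‖ ^ 2 * ‖H y‖ ^ 2 * w y) (a := fun y => CH * (‖ω y‖ ^ 2 * w y)) (φ := Φ)
      (R := R) (M := CH * ∫ y, ‖ω y‖ ^ 2 * η y ∂μ) (N := cthickening R (tsupport w))
      (fun y => mul_nonneg (mul_nonneg (sq_nonneg _) (sq_nonneg _)) (hw0 y))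
      ((((hωc.norm.pow 2).mul (hHc.norm.pow 2)).mul hwc).aestronglyMeasurable)
      (fun y => mul_nonneg hCH (mul_nonneg (sq_nonneg _) (hw0 y)))
      (continuous_const.mul ((hωc.norm.pow 2).mul hwc)) hΦ0 hΦc
      (mul_nonneg hCH (integral_nonneg fun y => mul_nonneg (sq_nonneg _) ((hw0 y).trans (hwη y))))
      (fun y => ?_) (fun x => ?_) isClosed_cthickening.measurableSet hNa
      (hΦc.continuousOn.integrableOn_compact (hK.cthickening))
    · calc ∫ y, ‖ω y‖ ^ 2 * ‖H y‖ ^ 2 * w y ∂μ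
          ≤ (CH * ∫ y, ‖ω y‖ ^ 2 * η y ∂μ) * ∫ x in cthickening R (tsupport w), Φ x ∂μ := h
        _ = _ := by ring
    · -- pointwise bound
      calc ‖ω y‖ ^ 2 * ‖H y‖ ^ 2 * w y = (‖ω y‖ ^ 2 * w y) * ‖H y‖ ^ 2 := by ring
        _ ≤ (‖ω y‖ ^ 2 * w y) * (CH * ∫ x in closedBall y R, Φ x ∂μ) :=
            mul_le_mul_of_nonneg_left (hH y) (mul_nonneg (sq_nonneg _) (hw0 y))
        _ = CH * (‖ω y‖ ^ 2 * w y) * ∫ x in closedBall y R, Φ x ∂μ := by ring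
    · -- local weighted masses are bounded by the total weighted mass
      rw [integral_const_mul]
      refine mul_le_mul_of_nonneg_left ?_ hCH
      calc ∫ y in closedBall x R, ‖ω y‖ ^ 2 * w y ∂μ ≤ ∫ y, ‖ω y‖ ^ 2 * w y ∂μ :=
            setIntegral_le_integral (((hωc.norm.pow 2).mul hwc).integrable_of_hasCompactSupport
              hws.mul_left) (Eventually.of_forall fun y => mul_nonneg (sq_nonneg _) (hw0 y))
        _ ≤ ∫ y, ‖ω y‖ ^ 2 * η y ∂μ :=
            integral_mono_of_nonneg (Eventually.of_forall fun y => mul_nonneg (sq_nonneg _) (hw0 y))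
              hηint (Eventually.of_forall fun y => mul_le_mul_of_nonneg_left (hwη y) (sq_nonneg _))
  have hI0 : 0 ≤ ∫ y, A y * ‖ω y‖ * ‖H y‖ * w y ∂μ :=
    integral_nonneg fun y => mul_nonneg (mul_nonneg (mul_nonneg (hA0 y) (norm_nonneg _))
      (norm_nonneg _)) (hw0 y)
  have h1 : 0 ≤ ∫ y, A y ^ 2 * w y ∂μ := integral_nonneg fun y => mul_nonneg (sq_nonneg _) (hw0 y)
  have h2 : 0 ≤ ∫ y, ‖ω y‖ ^ 2 * ‖H y‖ ^ 2 * w y ∂μ := integral_nonneg fun y => by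
    have := hw0 y; positivity
  calc (∫ y, A y * ‖ω y‖ * ‖H y‖ * w y ∂μ) ^ 2
      ≤ (Real.sqrt (∫ y, A y ^ 2 * w y ∂μ) * Real.sqrt (∫ y, ‖ω y‖ ^ 2 * ‖H y‖ ^ 2 * w y ∂μ)) ^ 2 :=
        pow_le_pow_left₀ hI0 hCS 2
    _ = (∫ y, A y ^ 2 * w y ∂μ) * ∫ y, ‖ω y‖ ^ 2 * ‖H y‖ ^ 2 * w y ∂μ := by
        rw [mul_pow, Real.sq_sqrt h1, Real.sq_sqrt h2]
    _ ≤ (∫ y, A y ^ 2 * w y ∂μ) * ((∫ y, ‖ω y‖ ^ 2 * η y ∂μ) *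
          (CH * ∫ x in cthickening R (tsupport w), Φ x ∂μ)) := mul_le_mul_of_nonneg_left hX h1
    _ = _ := by ring

/-- **The bound for `II`.** Let `S` be compact, `ω`, `H`, `Φ ≥ 0` continuous, and suppose
`‖H(y)‖² ≤ C_H ∫_{B̄(y,R)} Φ` for all `y` and that the local masses near `S` are bounded,
`∫_{B̄(x,R) ∩ S} ‖ω‖² ≤ m`. Then `(∫_S ‖ω‖²‖H‖)² ≤ (C_H m ∫_N Φ) ∫_S ‖ω‖²`, `N` the closed
`R`-neighbourhood of `S`. [folklore] -/
theorem sq_setIntegral_sq_norm_mul_norm_le {ω : E → F} {H : E → G} {Φ : E → ℝ} {S : Set E}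
    (hS : IsCompact S) (hωc : Continuous ω) (hHc : Continuous H) (hΦc : Continuous Φ)
    (hΦ0 : ∀ x, 0 ≤ Φ x) {CH R m : ℝ} (hCH : 0 ≤ CH) (hR : 0 ≤ R) (hm0 : 0 ≤ m)
    (hH : ∀ y, ‖H y‖ ^ 2 ≤ CH * ∫ x in closedBall y R, Φ x ∂μ)
    (hm : ∀ x, ∫ y in closedBall x R ∩ S, ‖ω y‖ ^ 2 ∂μ ≤ m) :
    (∫ y in S, ‖ω y‖ ^ 2 * ‖H y‖ ∂μ) ^ 2 ≤
      (CH * m * ∫ x in cthickening R S, Φ x ∂μ) * ∫ y in S, ‖ω y‖ ^ 2 ∂μ := by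
  have hSm : MeasurableSet S := hS.isClosed.measurableSet
  have hSt : μ S ≠ ∞ := hS.measure_lt_top.ne
  haveI : IsFiniteMeasure (μ.restrict S) := isFiniteMeasure_restrict.2 hSt
  -- Cauchy–Schwarz on `S` with `f = ‖ω‖ ‖H‖`, `g = ‖ω‖`
  have hint1 : IntegrableOn (fun y => ‖(‖ω y‖ * ‖H y‖)‖ ^ 2) S μ :=
    ((hωc.norm.mul hHc.norm).norm.pow 2).continuousOn.integrableOn_compact hS
  have hint2 : IntegrableOn (fun y => ‖(‖ω y‖)‖ ^ 2) S μ :=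
    (hωc.norm.norm.pow 2).continuousOn.integrableOn_compact hS
  have hfm : MemLp (fun y => ‖ω y‖ * ‖H y‖) 2 (μ.restrict S) :=
    (memLp_two_iff_integrable_sq_norm (hωc.norm.mul hHc.norm).aestronglyMeasurable).2 hint1
  have hgm : MemLp (fun y => ‖ω y‖) 2 (μ.restrict S) :=
    (memLp_two_iff_integrable_sq_norm hωc.norm.aestronglyMeasurable).2 hint2
  have hCS := integral_norm_mul_norm_le_sqrt_mul_sqrt hfm hgm
  have e1 : ∀ y, ‖(‖ω y‖ * ‖H y‖)‖ * ‖(‖ω y‖)‖ = ‖ω y‖ ^ 2 * ‖H y‖ := fun y => by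
    rw [Real.norm_of_nonneg (by positivity), Real.norm_of_nonneg (norm_nonneg _)]; ring
  have e2 : ∀ y, ‖(‖ω y‖ * ‖H y‖)‖ ^ 2 = ‖ω y‖ ^ 2 * ‖H y‖ ^ 2 := fun y => by
    rw [Real.norm_of_nonneg (by positivity)]; ring
  have e3 : ∀ y, ‖(‖ω y‖)‖ ^ 2 = ‖ω y‖ ^ 2 := fun y => by rw [norm_norm]
  simp_rw [e1, e2, e3] at hCS
  -- Tonelli for `1_S ‖ω‖² ‖H‖² ≤ (CH 1_S ‖ω‖²) ∫_{B̄} Φ`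
  have hX : ∫ y in S, ‖ω y‖ ^ 2 * ‖H y‖ ^ 2 ∂μ ≤ CH * m * ∫ x in cthickening R S, Φ x ∂μ := by
    have hNa : ∀ x ∉ cthickening R S, ∀ y ∈ tsupport (S.indicator fun y => CH * ‖ω y‖ ^ 2),
        R < dist y x := by
      intro x hx y hy
      refine lt_dist_of_notMem_cthickening hS hR hx ?_
      exact (closure_minimal (support_indicator_subset) hS.isClosed) hy
    have ham : Measurable (S.indicator fun y => CH * ‖ω y‖ ^ 2) :=
      (continuous_const.mul (hωc.norm.pow 2)).measurable.indicator hSm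
    have haint : ∀ x, IntegrableOn (S.indicator fun y => CH * ‖ω y‖ ^ 2) (closedBall x R) μ :=
      fun x => (((continuous_const.mul (hωc.norm.pow 2)).continuousOn.integrableOn_compact hS)
        |>.integrable_indicator hSm).integrableOn
    have h := integral_le_of_le_mul_setIntegral_closedBall' (μ := μ)
      (f := S.indicator fun y => ‖ω y‖ ^ 2 * ‖H y‖ ^ 2) (a := S.indicator fun y => CH * ‖ω y‖ ^ 2)
      (φ := Φ) (R := R) (M := CH * m) (N := cthickening R S)
      (fun y => indicator_nonneg (fun y _ => by positivity) y)
      ((((hωc.norm.pow 2).mul (hHc.norm.pow 2)).aestronglyMeasurable).indicator hSm)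
      (fun y => indicator_nonneg (fun y _ => by positivity) y) ham haint hΦ0 hΦc
      (mul_nonneg hCH hm0) (fun y => ?_) (fun x => ?_) isClosed_cthickening.measurableSet hNa
      (hΦc.continuousOn.integrableOn_compact hS.cthickening)
    · rwa [integral_indicator hSm] at h
    · by_cases hy : y ∈ S
      · rw [indicator_of_mem hy, indicator_of_mem hy]
        calc ‖ω y‖ ^ 2 * ‖H y‖ ^ 2 ≤ ‖ω y‖ ^ 2 * (CH * ∫ x in closedBall y R, Φ x ∂μ) :=
              mul_le_mul_of_nonneg_left (hH y) (sq_nonneg _)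
          _ = CH * ‖ω y‖ ^ 2 * ∫ x in closedBall y R, Φ x ∂μ := by ring
      · rw [indicator_of_notMem hy, indicator_of_notMem hy, zero_mul]
    · rw [integral_indicator hSm, Measure.restrict_restrict hSm, integral_const_mul, inter_comm]
      exact mul_le_mul_of_nonneg_left (hm x) hCH
  have hI0 : 0 ≤ ∫ y in S, ‖ω y‖ ^ 2 * ‖H y‖ ∂μ := integral_nonneg fun y => by positivity
  have h1 : 0 ≤ ∫ y in S, ‖ω y‖ ^ 2 * ‖H y‖ ^ 2 ∂μ := integral_nonneg fun y => by positivity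
  have h2 : 0 ≤ ∫ y in S, ‖ω y‖ ^ 2 ∂μ := integral_nonneg fun y => by positivity
  calc (∫ y in S, ‖ω y‖ ^ 2 * ‖H y‖ ∂μ) ^ 2
      ≤ (Real.sqrt (∫ y in S, ‖ω y‖ ^ 2 * ‖H y‖ ^ 2 ∂μ) * Real.sqrt (∫ y in S, ‖ω y‖ ^ 2 ∂μ)) ^ 2 :=
        pow_le_pow_left₀ hI0 hCS 2
    _ = (∫ y in S, ‖ω y‖ ^ 2 * ‖H y‖ ^ 2 ∂μ) * ∫ y in S, ‖ω y‖ ^ 2 ∂μ := by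
        rw [mul_pow, Real.sq_sqrt h1, Real.sq_sqrt h2]
    _ ≤ (CH * m * ∫ x in cthickening R S, Φ x ∂μ) * ∫ y in S, ‖ω y‖ ^ 2 ∂μ :=
        mul_le_mul_of_nonneg_right hX h2

end Literature.Analysis.FluidPDE.TaoY6

end
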